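import Mathlib
import Literature.NumberTheory.Transcendental.KZCalculusOver
import Summits.KontsevichZagierPeriods.KontsevichZagierPeriods.Theorems.SoloInformedRealDiscIdeal
import Summits.KontsevichZagierPeriods.KontsevichZagierPeriods.Theorems.SoloInformedBddMoves
import HarnessLib

/-!
# Real scalars on `KZ_ℝ`: integrand scaling makes `P_ℝ` an `ℝ`-module and `eval` `ℝ`-linear

File of the solo-informed residency (s225).  The real-coefficient calculus `KZ_ℝ`
(`KZOver.IntegralRep ℝ`, `KZOver.relations ℝ`, file `KZCalculusOver`) carries an action of the
real numbers that the rational calculus does not: **integrand scaling**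
`c • [σ, f] := [σ, c · f]` (`soloInformedRealScaleRep`), a real-semialgebraic datum for every real `c`.
This file proves that the action descends to real formal periods
`P_ℝ = FormalRep ℝ ⧸ relations ℝ` and records its algebra:

* `soloInformedRealScale c : FormalRep ℝ →+ FormalRep ℝ` and **`soloInformed_realScale_mem_relations` —
  `x ∈ relations ℝ → scale c x ∈ relations ℝ`**: each of the four moves is linear in the
  integrand / primitive, so `c •` sends a move to a move of the same kind
  (`…_of_mem_domainAddRel / integrandAddRel / changeOfVariablesRel / newtonLeibnizRel`).
* `soloInformedRealScaleQuot c` — the induced endomorphism of `P_ℝ`, with the module identities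
  `soloInformed_realScaleQuot_add / _mul / _one / _zero` (`(c + d) • x = c • x + d • x` is the
  integrand-additivity move; `(c d) • x = c • (d • x)` and `1 • x = x` hold already on
  representations), packaged as the explicit (non-instance) structure
  `soloInformedRealPeriodModule : Module ℝ P_ℝ`.
* `soloInformed_eval_realScale` — **`eval (c • x) = c · eval x`** (`eval` is `ℝ`-linear); `[π] ·` commutes with `c •`.
* `soloInformed_realRect_sub_realScale_mem_relations` — **real boxes are scalars**: the rectangle
  `[[0,1] × [0,ℓ], 1]` of THEOREM R (`soloInformedRealRect ℓ`) is `ℓ • [[0,1]², 1]` in `P_ℝ`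
  (`0 < ℓ`; the change of variables `(x, y) ↦ (x, ℓ y)`).

Bearing (residency verdict, `real-parameters.md` s224 addendum (S1)): THEOREM R reads `⟦r⟧ ≠ v • 1`,
and the open question `Q_ℝ` (`SoloInformedPiCancellationReal`, "`[π]` is a non-zero-divisor on `P_ℝ`")
concerns the `ℝ`-linear map `soloInformedDiscMulQuot`.  Nothing here decides `Q_ℝ`.
References: M. Kontsevich, D. Zagier, *Periods* (2001), §1.2 (the moves); J. Cresson, J. Viu-Sos,
JTNB 34 (2022), §1 (real semialgebraic data); J. Bochnak, M. Coste, M.-F. Roy, *Real Algebraic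
Geometry* (1998), Prop. 2.2.6.
-/

noncomputable section

open Set MeasureTheory MvPolynomial
open Literature.ModelTheory.ExponentialFields Literature.NumberTheory.Transcendental KZ

namespace Summit.KontsevichZagierPeriods.KontsevichZagierPeriods.Theorems

variable {n m d : ℕ}

/-! ### Integrand scaling on representations -/

/-- **Integrand scaling** `c • [σ, f] = [σ, c · f]` of a real-semialgebraic integral representation:
same domain, integrand multiplied by the real constant `c` (again `ℝ`-semialgebraic and absolutely
integrable). -/
def soloInformedRealScaleRep (c : ℝ) (r : KZOver.IntegralRep ℝ n) : KZOver.IntegralRep ℝ n where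
  domain := r.domain
  integrand x := c * r.integrand x
  isSemialgebraic_domain := r.isSemialgebraic_domain
  isSemialgebraicFunOn_integrand :=
    IsSemialgebraicFunOn.mul_holds
      ((isSemialgebraicFunOn_aeval r.isSemialgebraic_domain (C c : MvPolynomial (Fin n) ℝ)).congr
        fun x _ => by simp)
      r.isSemialgebraicFunOn_integrand
  integrableOn := r.integrableOn.integrable.const_mul c

/-- The domain of `c • r` is the domain of `r`. -/
@[simp] theorem soloInformed_realScaleRep_domain (c : ℝ) (r : KZOver.IntegralRep ℝ n) :
    (soloInformedRealScaleRep c r).domain = r.domain := rfl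

/-- The integrand of `c • r` is `c · f`. -/
@[simp] theorem soloInformed_realScaleRep_integrand (c : ℝ) (r : KZOver.IntegralRep ℝ n)
    (x : Fin n → ℝ) : (soloInformedRealScaleRep c r).integrand x = c * r.integrand x := rfl

/-- **`value (c • r) = c · value r`.** -/
@[simp] theorem soloInformed_realScaleRep_value (c : ℝ) (r : KZOver.IntegralRep ℝ n) :
    (soloInformedRealScaleRep c r).value = c * r.value := by
  simp only [KZOver.IntegralRep.value, soloInformed_realScaleRep_integrand, soloInformed_realScaleRep_domain]
  exact integral_const_mul c r.integrand

/-- `(c d) • r = c • (d • r)` on representations. -/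
theorem soloInformed_realScaleRep_mul (c d : ℝ) (r : KZOver.IntegralRep ℝ n) :
    soloInformedRealScaleRep (c * d) r = soloInformedRealScaleRep c (soloInformedRealScaleRep d r) :=
  KZOver.IntegralRep.ext rfl (funext fun x => mul_assoc c d (r.integrand x))

/-- `1 • r = r` on representations. -/
theorem soloInformed_realScaleRep_one (r : KZOver.IntegralRep ℝ n) : soloInformedRealScaleRep 1 r = r :=
  KZOver.IntegralRep.ext rfl (funext fun x => one_mul (r.integrand x))

/-! ### Integrand scaling on formal combinations -/

/-- **Integrand scaling on formal combinations**: the additive endomorphism of `FormalRep ℝ`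
induced by `soloInformedRealScaleRep c` on generators. -/
def soloInformedRealScale (c : ℝ) : KZOver.FormalRep ℝ →+ KZOver.FormalRep ℝ :=
  FreeAbelianGroup.map fun r => ⟨r.1, soloInformedRealScaleRep c r.2⟩

/-- `scale c` on a generator. -/
@[simp] theorem soloInformed_realScale_of (c : ℝ) (r : KZOver.IntegralRep ℝ n) :
    soloInformedRealScale c (KZOver.of r) = KZOver.of (soloInformedRealScaleRep c r) := rfl

/-- `(c d) • x = c • (d • x)` on formal combinations (an equality, not only a relation). -/
theorem soloInformed_realScale_mul (c d : ℝ) (x : KZOver.FormalRep ℝ) :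
    soloInformedRealScale (c * d) x = soloInformedRealScale c (soloInformedRealScale d x) := by
  have h : soloInformedRealScale (c * d) = (soloInformedRealScale c).comp (soloInformedRealScale d) :=
    FreeAbelianGroup.lift_ext _ _ fun ⟨n, r⟩ => by
      change soloInformedRealScale (c * d) (KZOver.of r) =
        soloInformedRealScale c (soloInformedRealScale d (KZOver.of r))
      rw [soloInformed_realScale_of, soloInformed_realScale_of, soloInformed_realScale_of, soloInformed_realScaleRep_mul]
  exact DFunLike.congr_fun h x

/-- `1 • x = x` on formal combinations (an equality). -/
theorem soloInformed_realScale_one (x : KZOver.FormalRep ℝ) : soloInformedRealScale 1 x = x := by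
  have h : soloInformedRealScale 1 = AddMonoidHom.id _ :=
    FreeAbelianGroup.lift_ext _ _ fun ⟨n, r⟩ => by
      change soloInformedRealScale 1 (KZOver.of r) = KZOver.of r
      rw [soloInformed_realScale_of, soloInformed_realScaleRep_one]
  exact DFunLike.congr_fun h x

/-- **`eval (c • x) = c · eval x`** on formal combinations. -/
theorem soloInformed_eval_realScale (c : ℝ) (x : KZOver.FormalRep ℝ) :
    KZOver.eval ℝ (soloInformedRealScale c x) = c * KZOver.eval ℝ x := by
  induction x using FreeAbelianGroup.induction_on with
  | zero => simp
  | of x =>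
    obtain ⟨m, s⟩ := x
    show KZOver.eval ℝ (soloInformedRealScale c (KZOver.of s)) = c * KZOver.eval ℝ (KZOver.of s)
    rw [soloInformed_realScale_of, KZOver.eval_of, KZOver.eval_of, soloInformed_realScaleRep_value]
  | neg x ih => simp only [map_neg, ih, mul_neg]
  | add x y hx hy => simp only [map_add, hx, hy, mul_add]

/-- An additive endomorphism of `FormalRep ℝ` that sends every generator into `relations ℝ` sends
everything into `relations ℝ`. -/
theorem soloInformed_mem_relations_of_forall_of {D : KZOver.FormalRep ℝ →+ KZOver.FormalRep ℝ}
    (h : ∀ (n : ℕ) (r : KZOver.IntegralRep ℝ n), D (KZOver.of r) ∈ KZOver.relations ℝ)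
    (x : KZOver.FormalRep ℝ) : D x ∈ KZOver.relations ℝ := by
  have hcomp : (QuotientAddGroup.mk' (KZOver.relations ℝ)).comp D = 0 :=
    FreeAbelianGroup.lift_ext _ _ fun ⟨n, r⟩ => by
      change ((D (KZOver.of r) : KZOver.FormalRep ℝ) : KZOver.FormalRep ℝ ⧸ KZOver.relations ℝ) = 0
      exact (QuotientAddGroup.eq_zero_iff _).mpr (h n r)
  have hx := DFunLike.congr_fun hcomp x
  exact (QuotientAddGroup.eq_zero_iff _).mp hx

/-- **`(c + d) • x − c • x − d • x ∈ relations ℝ`**: on a generator this is the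
integrand-additivity move `[σ, (c+d) f] − [σ, c f] − [σ, d f]`. -/
theorem soloInformed_realScale_add_mem_relations (c d : ℝ) (x : KZOver.FormalRep ℝ) :
    soloInformedRealScale (c + d) x - soloInformedRealScale c x - soloInformedRealScale d x ∈
      KZOver.relations ℝ := by
  refine soloInformed_mem_relations_of_forall_of
    (D := soloInformedRealScale (c + d) - soloInformedRealScale c - soloInformedRealScale d) (fun n r => ?_) x
  simp only [AddMonoidHom.sub_apply, soloInformed_realScale_of]
  exact KZOver.integrandAddRel_subset_relations ⟨n, soloInformedRealScaleRep (c + d) r,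
    soloInformedRealScaleRep c r, soloInformedRealScaleRep d r, rfl, rfl,
    fun y _ => by simp only [Pi.add_apply, soloInformed_realScaleRep_integrand, add_mul], rfl⟩

/-- **`0 • x ∈ relations ℝ`**: `[σ, 0] − [σ, 0] − [σ, 0]` is an integrand-additivity move. -/
theorem soloInformed_realScale_zero_mem_relations (x : KZOver.FormalRep ℝ) :
    soloInformedRealScale 0 x ∈ KZOver.relations ℝ := by
  refine soloInformed_mem_relations_of_forall_of (D := soloInformedRealScale 0) (fun n r => ?_) x
  rw [soloInformed_realScale_of]
  have h : KZOver.of (soloInformedRealScaleRep 0 r) - KZOver.of (soloInformedRealScaleRep 0 r) -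
      KZOver.of (soloInformedRealScaleRep 0 r) ∈ KZOver.relations ℝ :=
    KZOver.integrandAddRel_subset_relations ⟨n, soloInformedRealScaleRep 0 r, soloInformedRealScaleRep 0 r,
      soloInformedRealScaleRep 0 r, rfl, rfl,
      fun y _ => by simp only [Pi.add_apply, soloInformed_realScaleRep_integrand, zero_mul, add_zero], rfl⟩
  rw [sub_self, zero_sub] at h
  exact (KZOver.relations ℝ).neg_mem_iff.mp h

/-! ### The four moves under `c •` -/

/-- `c •` (domain additivity) is a domain-additivity move. -/
theorem soloInformed_realScale_mem_relations_of_mem_domainAddRel (c : ℝ) {x : KZOver.FormalRep ℝ}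
    (hx : x ∈ KZOver.domainAddRel ℝ) : soloInformedRealScale c x ∈ KZOver.relations ℝ := by
  obtain ⟨n, r, r₁, r₂, hdom, hnull, h₁, h₂, rfl⟩ := hx
  rw [map_sub, map_sub, soloInformed_realScale_of, soloInformed_realScale_of, soloInformed_realScale_of]
  exact KZOver.domainAddRel_subset_relations ⟨n, soloInformedRealScaleRep c r, soloInformedRealScaleRep c r₁,
    soloInformedRealScaleRep c r₂, hdom, hnull, fun y hy => congrArg (fun t => c * t) (h₁ hy),
    fun y hy => congrArg (fun t => c * t) (h₂ hy), rfl⟩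

/-- `c •` (integrand additivity) is an integrand-additivity move. -/
theorem soloInformed_realScale_mem_relations_of_mem_integrandAddRel (c : ℝ) {x : KZOver.FormalRep ℝ}
    (hx : x ∈ KZOver.integrandAddRel ℝ) : soloInformedRealScale c x ∈ KZOver.relations ℝ := by
  obtain ⟨n, r, r₁, r₂, hd₁, hd₂, hadd, rfl⟩ := hx
  rw [map_sub, map_sub, soloInformed_realScale_of, soloInformed_realScale_of, soloInformed_realScale_of]
  refine KZOver.integrandAddRel_subset_relations ⟨n, soloInformedRealScaleRep c r,
    soloInformedRealScaleRep c r₁, soloInformedRealScaleRep c r₂, hd₁, hd₂, fun y hy => ?_, rfl⟩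
  have h := hadd hy
  simp only [Pi.add_apply] at h ⊢
  simp only [soloInformed_realScaleRep_integrand, h, mul_add]

/-- `c •` (change of variables) is a change-of-variables move with the same `Φ`, `Φ'`:
`c f = (c f') ∘ Φ · |det Φ'|`. -/
theorem soloInformed_realScale_mem_relations_of_mem_changeOfVariablesRel (c : ℝ)
    {x : KZOver.FormalRep ℝ} (hx : x ∈ KZOver.changeOfVariablesRel ℝ) :
    soloInformedRealScale c x ∈ KZOver.relations ℝ := by
  obtain ⟨n, r, r', Φ, Φ', hΦ, hΦ', hinj, hdom, hf, rfl⟩ := hx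
  rw [map_sub, soloInformed_realScale_of, soloInformed_realScale_of]
  refine KZOver.changeOfVariablesRel_subset_relations ⟨n, soloInformedRealScaleRep c r,
    soloInformedRealScaleRep c r', Φ, Φ', hΦ, hΦ', hinj, hdom, fun y hy => ?_, rfl⟩
  simp only [soloInformed_realScaleRep_integrand]
  rw [hf y hy, mul_assoc]

/-- `c •` (Newton–Leibniz) is a Newton–Leibniz move with the same band and the primitive `c F`. -/
theorem soloInformed_realScale_mem_relations_of_mem_newtonLeibnizRel (c : ℝ) {x : KZOver.FormalRep ℝ}
    (hx : x ∈ KZOver.newtonLeibnizRel ℝ) : soloInformedRealScale c x ∈ KZOver.relations ℝ := by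
  obtain ⟨n, r, r', a, b, F, hF, ha, hb, hab, hdom, hcont, hderiv, hr', rfl⟩ := hx
  rw [map_sub, soloInformed_realScale_of, soloInformed_realScale_of]
  refine KZOver.newtonLeibnizRel_subset_relations ⟨n, soloInformedRealScaleRep c r,
    soloInformedRealScaleRep c r', a, b, fun w => c * F w, ?_, ha, hb, hab, hdom, ?_, ?_, ?_, rfl⟩
  · exact IsSemialgebraicFunOn.mul_holds
      ((isSemialgebraicFunOn_aeval r.isSemialgebraic_domain
        (C c : MvPolynomial (Fin (n + 1)) ℝ)).congr fun x _ => by simp) hF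
  · intro z hz
    exact continuousOn_const.mul (hcont z hz)
  · intro z hz s hs
    simp only [soloInformed_realScaleRep_integrand]
    exact (hderiv z hz s hs).const_mul c
  · intro z hz
    simp only [soloInformed_realScaleRep_integrand]
    rw [hr' z hz, mul_sub]

/-- **`c •` preserves the relations of `KZ_ℝ`** (subgroup form). -/
theorem soloInformed_map_realScale_relations_le (c : ℝ) :
    (KZOver.relations ℝ).map (soloInformedRealScale c) ≤ KZOver.relations ℝ := by
  rw [KZOver.relations, AddMonoidHom.map_closure]
  refine (AddSubgroup.closure_le _).mpr ?_
  rintro _ ⟨x, (((hx | hx) | hx) | hx), rfl⟩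
  · exact soloInformed_realScale_mem_relations_of_mem_domainAddRel c hx
  · exact soloInformed_realScale_mem_relations_of_mem_integrandAddRel c hx
  · exact soloInformed_realScale_mem_relations_of_mem_changeOfVariablesRel c hx
  · exact soloInformed_realScale_mem_relations_of_mem_newtonLeibnizRel c hx

/-- **`c •` preserves the relations of `KZ_ℝ`**: `x ∈ relations ℝ → c • x ∈ relations ℝ`. -/
theorem soloInformed_realScale_mem_relations (c : ℝ) {x : KZOver.FormalRep ℝ}
    (hx : x ∈ KZOver.relations ℝ) : soloInformedRealScale c x ∈ KZOver.relations ℝ :=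
  soloInformed_map_realScale_relations_le c (AddSubgroup.mem_map_of_mem _ hx)

/-- `[π] ·` commutes with `c •` on formal combinations: `D̄ × [σ, c f] = c • (D̄ × [σ, f])`. -/
theorem soloInformed_discMul_realScale (c : ℝ) (x : KZOver.FormalRep ℝ) :
    soloInformedDiscMul (soloInformedRealScale c x) = soloInformedRealScale c (soloInformedDiscMul x) := by
  have h : soloInformedDiscMul.comp (soloInformedRealScale c) =
      (soloInformedRealScale c).comp soloInformedDiscMul :=
    FreeAbelianGroup.lift_ext _ _ fun ⟨n, r⟩ => by
      change soloInformedDiscMul (soloInformedRealScale c (KZOver.of r)) =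
        soloInformedRealScale c (soloInformedDiscMul (KZOver.of r))
      rw [soloInformed_realScale_of, soloInformed_discMul_of, soloInformed_discMul_of, soloInformed_realScale_of]
      rfl
  exact DFunLike.congr_fun h x

/-! ### The `ℝ`-module `P_ℝ` -/

/-- **Real scalars on real formal periods** `P_ℝ = FormalRep ℝ ⧸ relations ℝ`: the endomorphism
induced by `c •` (well defined by `soloInformed_realScale_mem_relations`). -/
def soloInformedRealScaleQuot (c : ℝ) :
    KZOver.FormalRep ℝ ⧸ KZOver.relations ℝ →+ KZOver.FormalRep ℝ ⧸ KZOver.relations ℝ :=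
  QuotientAddGroup.map (KZOver.relations ℝ) (KZOver.relations ℝ) (soloInformedRealScale c)
    fun _ hx => soloInformed_realScale_mem_relations c hx

/-- `scaleQuot c` on the class of `x` is the class of `c • x`. -/
@[simp] theorem soloInformed_realScaleQuot_mk (c : ℝ) (x : KZOver.FormalRep ℝ) :
    soloInformedRealScaleQuot c (x : KZOver.FormalRep ℝ ⧸ KZOver.relations ℝ) =
      ((soloInformedRealScale c x : KZOver.FormalRep ℝ) : KZOver.FormalRep ℝ ⧸ KZOver.relations ℝ) :=
  rfl

/-- **`(c + d) • p = c • p + d • p`** in `P_ℝ`. -/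
theorem soloInformed_realScaleQuot_add (c d : ℝ) (p : KZOver.FormalRep ℝ ⧸ KZOver.relations ℝ) :
    soloInformedRealScaleQuot (c + d) p = soloInformedRealScaleQuot c p + soloInformedRealScaleQuot d p := by
  induction p using QuotientAddGroup.induction_on with
  | H x =>
    rw [soloInformed_realScaleQuot_mk, soloInformed_realScaleQuot_mk, soloInformed_realScaleQuot_mk,
      ← QuotientAddGroup.mk_add, QuotientAddGroup.eq_iff_sub_mem, ← sub_sub]
    exact soloInformed_realScale_add_mem_relations c d x

/-- **`(c d) • p = c • (d • p)`** in `P_ℝ`. -/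
theorem soloInformed_realScaleQuot_mul (c d : ℝ) (p : KZOver.FormalRep ℝ ⧸ KZOver.relations ℝ) :
    soloInformedRealScaleQuot (c * d) p = soloInformedRealScaleQuot c (soloInformedRealScaleQuot d p) := by
  induction p using QuotientAddGroup.induction_on with
  | H x => rw [soloInformed_realScaleQuot_mk, soloInformed_realScaleQuot_mk, soloInformed_realScaleQuot_mk,
      soloInformed_realScale_mul]

/-- **`1 • p = p`** in `P_ℝ`. -/
theorem soloInformed_realScaleQuot_one (p : KZOver.FormalRep ℝ ⧸ KZOver.relations ℝ) :
    soloInformedRealScaleQuot 1 p = p := by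
  induction p using QuotientAddGroup.induction_on with
  | H x => rw [soloInformed_realScaleQuot_mk, soloInformed_realScale_one]

/-- **`0 • p = 0`** in `P_ℝ`. -/
theorem soloInformed_realScaleQuot_zero (p : KZOver.FormalRep ℝ ⧸ KZOver.relations ℝ) :
    soloInformedRealScaleQuot 0 p = 0 := by
  induction p using QuotientAddGroup.induction_on with
  | H x =>
    rw [soloInformed_realScaleQuot_mk, QuotientAddGroup.eq_zero_iff]
    exact soloInformed_realScale_zero_mem_relations x

/-- **`P_ℝ` is an `ℝ`-module** under integrand scaling (an explicit structure, deliberately not an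
instance): `c • p := soloInformedRealScaleQuot c p`. -/
@[reducible] def soloInformedRealPeriodModule : Module ℝ (KZOver.FormalRep ℝ ⧸ KZOver.relations ℝ) :=
  letI : SMul ℝ (KZOver.FormalRep ℝ ⧸ KZOver.relations ℝ) := ⟨fun c p => soloInformedRealScaleQuot c p⟩
  Module.ofMinimalAxioms
    (fun c p q => (soloInformedRealScaleQuot c).map_add p q)
    (fun c d p => soloInformed_realScaleQuot_add c d p)
    (fun c d p => soloInformed_realScaleQuot_mul c d p)
    (fun p => soloInformed_realScaleQuot_one p)

/-- **`eval` is `ℝ`-linear on `P_ℝ`**: the evaluation map `P_ℝ → ℝ` induced by `KZOver.eval ℝ`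
(which kills `relations ℝ`) satisfies `eval (c • p) = c · eval p`. -/
theorem soloInformed_evalQuot_realScaleQuot (c : ℝ) (p : KZOver.FormalRep ℝ ⧸ KZOver.relations ℝ) :
    QuotientAddGroup.lift (KZOver.relations ℝ) (KZOver.eval ℝ) (KZOver.relations_le_ker_eval ℝ)
        (soloInformedRealScaleQuot c p) =
      c * QuotientAddGroup.lift (KZOver.relations ℝ) (KZOver.eval ℝ) (KZOver.relations_le_ker_eval ℝ) p := by
  induction p using QuotientAddGroup.induction_on with
  | H x =>
    rw [soloInformed_realScaleQuot_mk, QuotientAddGroup.lift_mk, QuotientAddGroup.lift_mk,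
      soloInformed_eval_realScale]

/-- **`Q_ℝ`'s map is `ℝ`-linear**: `[π] ·` on `P_ℝ` (`soloInformedDiscMulQuot`) commutes with the
real scalars. -/
theorem soloInformed_discMulQuot_realScaleQuot (c : ℝ) (p : KZOver.FormalRep ℝ ⧸ KZOver.relations ℝ) :
    soloInformedDiscMulQuot (soloInformedRealScaleQuot c p) =
      soloInformedRealScaleQuot c (soloInformedDiscMulQuot p) := by
  induction p using QuotientAddGroup.induction_on with
  | H x =>
    rw [soloInformed_realScaleQuot_mk, soloInformed_discMulQuot_mk, soloInformed_discMulQuot_mk,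
      soloInformed_realScaleQuot_mk, soloInformed_discMul_realScale]

/-! ### Real boxes are scalars -/

/-- **Real boxes are scalars**: for `0 < ℓ`, `ℓ • [[0,1]², 1] − [[0,1] × [0,ℓ], 1]` is the
change-of-variables move `(x, y) ↦ (x, ℓ y)` (diagonal, `|det| = ℓ`), so THEOREM R's rectangle
`soloInformedRealRect ℓ` is `ℓ • soloInformedRealRect 1` in `P_ℝ`. -/
theorem soloInformed_realScaleRep_rect_sub_rect_mem_changeOfVariablesRel {ℓ : ℝ} (hℓ : 0 < ℓ) :
    KZOver.of (soloInformedRealScaleRep ℓ (soloInformedRealRect 1)) -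
        KZOver.of (soloInformedRealRect ℓ) ∈ KZOver.changeOfVariablesRel ℝ := by
  set dv : Fin 2 → ℝ := soloInformedRealRectSide ℓ with hdv
  have hd0 : dv 0 = 1 := by simp [hdv, soloInformedRealRectSide]
  have hd1 : dv 1 = ℓ := by simp [hdv, soloInformedRealRectSide]
  have hdne : ∀ i, dv i ≠ 0 := by
    intro i; fin_cases i
    · simp [hd0]
    · simpa [hd1] using hℓ.ne'
  let L : (Fin 2 → ℝ) →L[ℝ] (Fin 2 → ℝ) :=
    LinearMap.toContinuousLinearMap (Matrix.toLin' (Matrix.diagonal dv))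
  have hL : ∀ x, L x = fun i => dv i * x i := by
    intro x; ext i
    simp [L, Matrix.mulVec_diagonal]
  have hLfun : (⇑L) = fun x i => dv i * x i := funext hL
  have hdet : L.det = ℓ := by
    simp only [L, ContinuousLinearMap.det, LinearMap.coe_toContinuousLinearMap, LinearMap.det_toLin',
      Matrix.det_diagonal, Fin.prod_univ_two, hd0, hd1, one_mul]
  have hσ : IsSemialgebraic ℝ (soloInformedRealRect (1 : ℝ)).domain :=
    (soloInformedRealRect 1).isSemialgebraic_domain
  refine ⟨2, soloInformedRealScaleRep ℓ (soloInformedRealRect 1), soloInformedRealRect ℓ,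
    fun x i => dv i * x i, fun _ => L, ?_, ?_, ?_, ?_, ?_, rfl⟩
  · refine (isSemialgebraicMapOn_aeval hσ (fun j => C (dv j) * X j)).congr fun x _ => ?_
    ext j
    simp
  · intro x _
    have h := (L.hasFDerivAt (x := x)).hasFDerivWithinAt
      (s := (soloInformedRealScaleRep ℓ (soloInformedRealRect 1)).domain)
    rw [hLfun] at h
    exact h
  · intro x _ y _ hxy
    ext i
    have hi := congr_fun hxy i
    exact mul_left_cancel₀ (hdne i) hi
  · ext y
    rw [soloInformed_mem_rect_domain_iff, mem_image]
    constructor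
    · rintro ⟨h0, h1⟩
      refine ⟨fun i => y i / dv i, ?_, ?_⟩
      · rw [soloInformed_realScaleRep_domain, soloInformed_mem_rect_domain_iff, hd0, hd1]
        refine ⟨⟨by simpa using h0.1, by simpa using h0.2⟩, ⟨div_nonneg h1.1 hℓ.le, ?_⟩⟩
        exact (div_le_one hℓ).mpr h1.2
      · ext i
        exact mul_div_cancel₀ (y i) (hdne i)
    · rintro ⟨x, hx, rfl⟩
      rw [soloInformed_realScaleRep_domain, soloInformed_mem_rect_domain_iff] at hx
      simp only [hd0, hd1, one_mul]
      exact ⟨hx.1, ⟨mul_nonneg hℓ.le hx.2.1, mul_le_of_le_one_right hℓ.le hx.2.2⟩⟩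
  · intro x _
    rw [soloInformed_realScaleRep_integrand, soloInformedRealRect_integrand,
      soloInformedRealRect_integrand, hdet, abs_of_pos hℓ, mul_one, one_mul]

/-- **`⟦[[0,1] × [0,ℓ], 1]⟧ = ℓ • ⟦[[0,1]², 1]⟧` in `P_ℝ`** (`0 < ℓ`): the real boxes of THEOREM R are
scalar multiples of the unit square. -/
theorem soloInformed_rect_eq_realScaleQuot {ℓ : ℝ} (hℓ : 0 < ℓ) :
    ((KZOver.of (soloInformedRealRect ℓ) : KZOver.FormalRep ℝ) :
        KZOver.FormalRep ℝ ⧸ KZOver.relations ℝ) =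
      soloInformedRealScaleQuot ℓ
        ((KZOver.of (soloInformedRealRect 1) : KZOver.FormalRep ℝ) :
          KZOver.FormalRep ℝ ⧸ KZOver.relations ℝ) := by
  rw [soloInformed_realScaleQuot_mk, soloInformed_realScale_of, eq_comm, QuotientAddGroup.eq_iff_sub_mem]
  exact KZOver.changeOfVariablesRel_subset_relations
    (soloInformed_realScaleRep_rect_sub_rect_mem_changeOfVariablesRel hℓ)

end Summit.KontsevichZagierPeriods.KontsevichZagierPeriods.Theorems
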